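import Mathlib
import HarnessLib
import Summits.AtomisticToContinuum.Crystallization.Theorems.PricedLinkCensusSoftFourRingsCapCertValid
import Summits.AtomisticToContinuum.Crystallization.Theorems.PricedLinkCensusSoftFourRingsPathFamily

/-!
# Bond-to-cap certificate: bond bookkeeping: distinctness/closeness of bonded pairs and double counting over bonds (four per point) and non-bonds (seven per point)

Route `PricedLinkCensus`, item `SoftFourRings` (stmt-AtomisticToContinuum-14234), crux `Cap.BondToCap`
(seat c3).  Part 3/5 of the semantics-and-soundness layer of the certificate checker
(`PricedLinkCensusSoftFourRingsCapCertComp`).  Master valid inequality, for a unit pole `p ∉ X` and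
unit vectors `X` (`u_x = ⟪p,x⟫`, `t_xy = ⟪x,y⟫`): `Σ_{x,y∈X} Ocore(u_x,u_y,t_xy) + Σ_x Dcross(u_x) + c₀ ≥ 0`;
splitting at each `x` into the diagonal, four bonded and seven non-bonded terms and moving the free
polynomials with the degree identities gives `0 ≤ Σ D + Σ O_b + Σ O_n + c₀ ≤ 12α + 48β_b + 84β_n + c₀ < 0`.
-/

namespace Summit.AtomisticToContinuum.Crystallization.Theorems.Cap.Cert

open Real RealInnerProductSpace Finset
open Literature.Geometry.DiscreteGeometry Literature.Geometry.DiscreteGeometry.PolyCert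
  Literature.Geometry.DiscreteGeometry.PolyCert.SPoly

/-! ### Bond bookkeeping -/

section Bonds

variable {X : Finset (EuclideanSpace ℝ (Fin 3))} {B : Finset (Finset (EuclideanSpace ℝ (Fin 3)))}

/-- Members of a bond are close. [folklore] -/
theorem inner_ge_of_bond
    (hB : ∀ T ∈ B, ∃ u ∈ X, ∃ u' ∈ X, u ≠ u' ∧ 1 - (101 / 100 : ℝ) ^ 2 / 2 ≤ ⟪u, u'⟫ ∧ T = {u, u'})
    {a b : EuclideanSpace ℝ (Fin 3)} (hab : ({a, b} : Finset (EuclideanSpace ℝ (Fin 3))) ∈ B) :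
    1 - (101 / 100 : ℝ) ^ 2 / 2 ≤ ⟪a, b⟫ := by
  have hne := ne_of_mem_bonds hB hab
  obtain ⟨u, -, u', -, -, hclose, hT⟩ := hB _ hab
  have ha : a ∈ ({u, u'} : Finset (EuclideanSpace ℝ (Fin 3))) := by
    rw [← hT]; exact Finset.mem_insert_self _ _
  have hb : b ∈ ({u, u'} : Finset (EuclideanSpace ℝ (Fin 3))) := by
    rw [← hT]; exact Finset.mem_insert_of_mem (Finset.mem_singleton_self _)
  simp only [Finset.mem_insert, Finset.mem_singleton] at ha hb
  rcases ha with rfl | rfl <;> rcases hb with rfl | rfl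
  · exact absurd rfl hne
  · exact hclose
  · rw [real_inner_comm]; exact hclose
  · exact absurd rfl hne

/-- **Double counting over bonds**: `Σ_x Σ_{y bonded to x} g(y) = 4 Σ_y g(y)`. [folklore] -/
theorem sum_sum_bond_right [DecidableEq (EuclideanSpace ℝ (Fin 3))]
    (hdeg : ∀ v ∈ X, ∃ w : Fin 4 → EuclideanSpace ℝ (Fin 3), (∀ k, w k ∈ X) ∧
      Function.Injective w ∧ (∀ k, w k ≠ v) ∧
      (∀ k, ({v, w k} : Finset (EuclideanSpace ℝ (Fin 3))) ∈ B) ∧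
      ∀ y, ({v, y} : Finset (EuclideanSpace ℝ (Fin 3))) ∈ B → ∃ k, y = w k)
    (g : EuclideanSpace ℝ (Fin 3) → ℝ) :
    ∑ x ∈ X, ∑ y ∈ X.filter (fun y => ({x, y} : Finset (EuclideanSpace ℝ (Fin 3))) ∈ B), g y =
      4 * ∑ y ∈ X, g y := by
  simp_rw [Finset.sum_filter]
  rw [Finset.sum_comm, Finset.mul_sum]
  refine Finset.sum_congr rfl fun y hy => ?_
  rw [← Finset.sum_filter]
  have hsym : X.filter (fun x => ({x, y} : Finset (EuclideanSpace ℝ (Fin 3))) ∈ B) =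
      X.filter (fun x => ({y, x} : Finset (EuclideanSpace ℝ (Fin 3))) ∈ B) := by
    ext x; simp [Finset.pair_comm]
  rw [hsym, Finset.sum_const]
  obtain ⟨w, hwX, hwinj, -, hwB, hall⟩ := hdeg y hy
  rw [card_filter_bond_eq_four hwX hwinj hwB hall]
  simp

/-- **Double counting over non-bonds**: `Σ_x Σ_{y ≠ x not bonded to x} g(y) = 7 Σ_y g(y)`.
[folklore] -/
theorem sum_sum_nonbond_right [DecidableEq (EuclideanSpace ℝ (Fin 3))] (hcard : X.card = 12)
    (hB : ∀ T ∈ B, ∃ u ∈ X, ∃ u' ∈ X, u ≠ u' ∧ 1 - (101 / 100 : ℝ) ^ 2 / 2 ≤ ⟪u, u'⟫ ∧ T = {u, u'})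
    (hdeg : ∀ v ∈ X, ∃ w : Fin 4 → EuclideanSpace ℝ (Fin 3), (∀ k, w k ∈ X) ∧
      Function.Injective w ∧ (∀ k, w k ≠ v) ∧
      (∀ k, ({v, w k} : Finset (EuclideanSpace ℝ (Fin 3))) ∈ B) ∧
      ∀ y, ({v, y} : Finset (EuclideanSpace ℝ (Fin 3))) ∈ B → ∃ k, y = w k)
    (g : EuclideanSpace ℝ (Fin 3) → ℝ) :
    ∑ x ∈ X, ∑ y ∈ X.filter (fun y => y ≠ x ∧ ({x, y} : Finset (EuclideanSpace ℝ (Fin 3))) ∉ B), g y =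
      7 * ∑ y ∈ X, g y := by
  simp_rw [Finset.sum_filter]
  rw [Finset.sum_comm, Finset.mul_sum]
  refine Finset.sum_congr rfl fun y hy => ?_
  rw [← Finset.sum_filter]
  have hsym : X.filter (fun x => y ≠ x ∧ ({x, y} : Finset (EuclideanSpace ℝ (Fin 3))) ∉ B) =
      X.filter (fun x => x ≠ y ∧ ({y, x} : Finset (EuclideanSpace ℝ (Fin 3))) ∉ B) := by
    ext x; simp [Finset.pair_comm, ne_comm]
  rw [hsym, Finset.sum_const]
  obtain ⟨w, hwX, hwinj, -, hwB, hall⟩ := hdeg y hy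
  rw [card_filter_nonbond_eq_seven hcard hB hy hwX hwinj hwB hall]
  simp

end Bonds

end Summit.AtomisticToContinuum.Crystallization.Theorems.Cap.Cert
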